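import Literature.Geometry.Symplectic.CircleInvariantForms
import Literature.Geometry.Symplectic.OrbitPeriodMomentMap
import Literature.Analysis.FunctionSpaces.OrbitMeanZeroPrimitive
import Mathlib.Analysis.SpecialFunctions.SmoothTransition
import HarnessLib

/-!
# The orbit period of a primitive of `ω` minus `π r` is locally constant (Hamiltonian circle action)

Topic `Literature/Geometry/Symplectic`; proofs file (layer "wrapping number on the tube",
manifold level) of the fact seat of
`Literature.Geometry.Symplectic.mclean_divisorComplement_convex_four` (M. McLean, *The growth
rate of symplectic homology and affine varieties*, GAFA 22 (2012), Lemma 5.17).  Setting: a free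
smooth circle action on a Hausdorff manifold `N` (model `𝓡 m`), a smooth `1`-form `θ` with
`dθ = σ`, and a smooth invariant function `H` whose Hamiltonian flow is the action:
`σ(X, ·) = dH` for the fundamental vector field `X` (McLean 2012, p. 37: on the punctured tube of
the divisor the rotation of the normal discs is generated by `-r²/2`).  Then
the **orbit period** `∮_{S¹·y} θ = ∫₀^{2π} θ_{e^{it}y}(X) dt` satisfies, writing the action as
the Hamiltonian flow of an invariant function `H` (`σ(X, ·) = dH`; on the tube `H = -r²/2`),

  `∮_{S¹·y} θ + 2π H(y)` **is locally constant in `y`** (`isLocallyConstant_orbitPeriod_add`)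

— McLean's wrapping number `κ = A - r²/2` (p. 36).  Proof: in the flat slice model
`(u, t) ↦ e^{it} · param u` of the tree (`CircleInvariantForms.sliceTrivR`) the orbits are the
lines `t ↦ (u, t)`, the pulled-back data are `2π`-periodic in `t`, and the chart-level statement
is `orbitPeriod_sub_eq_of_ends` (`OrbitPeriodMomentMap.lean`: first variation of the period
`=` flux of `σ` `=` `π d(r)` by the moment-map identity) applied to the segments
`s ↦ (smoothTransition s • u, t)`.

Everything is proved; no definitions, no named facts (D-0026).

## References

* M. McLean, *The growth rate of symplectic homology and affine varieties*, Geom. Funct. Anal. 22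
  (2012), pp. 36–37. [Mclean2012]
* D. McDuff, D. Salamon, *Introduction to Symplectic Topology*, 3rd ed. (2017), §5.5.
  [McDuffSalamon2017]
-/

noncomputable section

open scoped Manifold ContDiff Topology Real
open Set Function Filter MeasureTheory intervalIntegral
open Literature.Geometry.Kaehler Literature.Geometry.Manifold

namespace Literature.Geometry.Symplectic

variable {m : ℕ} {N : Type*} [TopologicalSpace N] [ChartedSpace (EuclideanSpace ℝ (Fin m)) N]
  [MulAction Circle N] {F : Type*} [NormedAddCommGroup F] [NormedSpace ℝ F]

/-! ### The slice model: periodicity and the orbit integrand -/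

section Slice

variable {p : N} (d : CircleSliceData (EuclideanSpace ℝ (Fin m)) F p)

/-- The slice trivialisation is `2π`-periodic in the flow time. [folklore] -/
theorem sliceTrivR_add_two_pi (u : F) (t : ℝ) :
    sliceTrivR d (u, t + 2 * π) = sliceTrivR d (u, t) := by
  have h := smul_sliceTrivR d (2 * π) (u, t)
  rw [Circle.exp_two_pi, one_smul] at h
  rw [h]
  simp

/-- The slice trivialisation along a line: `exp t • sliceTrivR (u, t₀) = sliceTrivR (u, t₀ + t)`.
[folklore] -/
theorem smul_sliceTrivR_mk (u : F) (t₀ t : ℝ) :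
    Circle.exp t • sliceTrivR d (u, t₀) = sliceTrivR d (u, t₀ + t) := by
  rw [smul_sliceTrivR d t (u, t₀)]
  simp

/-- The derivative of a periodic map repeats: `D(sliceTrivR)(u, t + 2π) = D(sliceTrivR)(u, t)`
on `dom × ℝ`. [folklore] -/
theorem mfderiv_sliceTrivR_add_two_pi
    (hθ : ContMDiff ((𝓡 1).prod (𝓡 m)) (𝓡 m) ∞ (fun x : Circle × N => x.1 • x.2))
    {u : F} (hu : u ∈ d.dom) (t : ℝ) :
    mfderiv 𝓘(ℝ, F × ℝ) (𝓡 m) (sliceTrivR d) (u, t + 2 * π) =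
      mfderiv 𝓘(ℝ, F × ℝ) (𝓡 m) (sliceTrivR d) (u, t) := by
  have hx' : ((u, t + 2 * π) : F × ℝ) ∈ sliceDomR d := by simpa [sliceDomR] using hu
  have hT : MDifferentiableAt 𝓘(ℝ, F × ℝ) (𝓡 m) (sliceTrivR d) (u, t + 2 * π) :=
    ((contMDiffOn_sliceTrivR d hθ).contMDiffAt
      ((isOpen_sliceDomR d).mem_nhds hx')).mdifferentiableAt (by simp)
  have htr : HasMFDerivAt 𝓘(ℝ, F × ℝ) 𝓘(ℝ, F × ℝ) (fun y : F × ℝ => y + ((0 : F), 2 * π)) (u, t)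
      (ContinuousLinearMap.id ℝ (F × ℝ)) :=
    hasMFDerivAt_iff_hasFDerivAt.2 ((hasFDerivAt_id _).add_const _)
  have heq : ((u, t) : F × ℝ) + ((0 : F), 2 * π) = (u, t + 2 * π) := by simp
  have hT' : MDifferentiableAt 𝓘(ℝ, F × ℝ) (𝓡 m) (sliceTrivR d)
      (((u, t) : F × ℝ) + ((0 : F), 2 * π)) := by
    rw [heq]; exact hT
  have hcomp := (hT'.hasMFDerivAt.comp (u, t) htr).mfderiv
  have hfun : (sliceTrivR d ∘ fun y : F × ℝ => y + ((0 : F), 2 * π)) = sliceTrivR d := by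
    funext y
    obtain ⟨u', t'⟩ := y
    show sliceTrivR d ((u', t') + ((0 : F), 2 * π)) = sliceTrivR d (u', t')
    rw [show ((u', t') : F × ℝ) + ((0 : F), 2 * π) = (u', t' + 2 * π) by simp]
    exact sliceTrivR_add_two_pi d u' t'
  rw [hfun] at hcomp
  rw [heq] at hcomp
  rw [hcomp]
  ext w
  rfl

/-- **The pulled-back form is `2π`-periodic in the flow time** on `dom × ℝ`. [folklore] -/
theorem pullback_sliceTrivR_add_two_pi {k : ℕ} (α : MForm (𝓡 m) N ℝ k)
    (hθ : ContMDiff ((𝓡 1).prod (𝓡 m)) (𝓡 m) ∞ (fun x : Circle × N => x.1 • x.2))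
    {u : F} (hu : u ∈ d.dom) (t : ℝ) :
    (α.pullback 𝓘(ℝ, F × ℝ) (sliceTrivR d)) (u, t + 2 * π) =
      (α.pullback 𝓘(ℝ, F × ℝ) (sliceTrivR d)) (u, t) := by
  have h1 := sliceTrivR_add_two_pi d u t
  have h2 := mfderiv_sliceTrivR_add_two_pi d hθ hu t
  -- transport along `h1` (the tangent spaces are all the model space)
  have key : ∀ (y y' : N), y = y' →
      ∀ (L L' : F × ℝ →L[ℝ] EuclideanSpace ℝ (Fin m)), L = L' →
        (α y).compContinuousLinearMap L = (α y').compContinuousLinearMap L' := by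
    rintro y y' rfl L L' rfl
    rfl
  exact key _ _ h1 _ _ h2

omit [TopologicalSpace N] [ChartedSpace (EuclideanSpace ℝ (Fin m)) N] [MulAction Circle N] in
/-- `![a]` pushed forward entrywise. [folklore] -/
private theorem comp_vecOne {X Y : Type*} (f : X → Y) (a : X) :
    (fun i : Fin 1 ↦ f (![a] i)) = ![f a] := by
  funext i; fin_cases i; rfl

omit [TopologicalSpace N] [ChartedSpace (EuclideanSpace ℝ (Fin m)) N] [MulAction Circle N] in
/-- `![a, b]` pushed forward entrywise. [folklore] -/
private theorem comp_vecTwo {X Y : Type*} (f : X → Y) (a b : X) :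
    (fun i : Fin 2 ↦ f (![a, b] i)) = ![f a, f b] := by
  funext i; fin_cases i <;> rfl

/-- **The orbit integrand in the slice model**: for `y = sliceTrivR (u, t₀)`,
`θ_{e^{it} y}(X(e^{it} y)) = (sliceTrivR^* θ)_{(u, t₀ + t)}(0, 1)`. [folklore] -/
theorem orbitIntegrand_sliceTrivR (θ1 : MForm (𝓡 m) N ℝ 1)
    (hθ : ContMDiff ((𝓡 1).prod (𝓡 m)) (𝓡 m) ∞ (fun x : Circle × N => x.1 • x.2))
    {u : F} (hu : u ∈ d.dom) (t₀ t : ℝ) :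
    θ1 (Circle.exp t • sliceTrivR d (u, t₀))
        ![circleFundVec (Circle.exp t • sliceTrivR d (u, t₀))] =
      (θ1.pullback 𝓘(ℝ, F × ℝ) (sliceTrivR d)) (u, t₀ + t) ![((0, 1) : F × ℝ)] := by
  have hx : ((u, t₀ + t) : F × ℝ) ∈ sliceDomR d := by simpa [sliceDomR] using hu
  rw [smul_sliceTrivR_mk, MForm.pullback_apply, comp_vecOne, mfderiv_sliceTrivR_inr d hθ hx]

end Slice

/-! ### The flat data of the slice model -/

section FlatData

variable [IsManifold (𝓡 m) ∞ N] {p : N} (d : CircleSliceData (EuclideanSpace ℝ (Fin m)) F p)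

/-- The pulled-back `1`-form is `C^∞` on `dom × ℝ` (as a map of the flat space). [folklore] -/
theorem contDiffOn_pullback_sliceTrivR {k : ℕ} {α : MForm (𝓡 m) N ℝ k}
    (hθ : ContMDiff ((𝓡 1).prod (𝓡 m)) (𝓡 m) ∞ (fun x : Circle × N => x.1 • x.2))
    (hsm : IsSmoothForm α) :
    ContDiffOn ℝ ∞ (E := F × ℝ) (F := (F × ℝ) [⋀^Fin k]→L[ℝ] ℝ)
      (α.pullback 𝓘(ℝ, F × ℝ) (sliceTrivR d)) (sliceDomR d) := fun _ hx ↦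
  (contDiffAt_of_smoothAt_self (smoothAt_pullback_sliceTrivR d hθ hsm hx)).contDiffWithinAt

/-- **Naturality of `d` in the slice model**: `d(sliceTrivR^* θ) = sliceTrivR^* (dθ)` on
`dom × ℝ`, with Mathlib's flat `extDeriv` on the left. [folklore] -/
theorem extDeriv_pullback_sliceTrivR_eq {k : ℕ} {α : MForm (𝓡 m) N ℝ k}
    (hθ : ContMDiff ((𝓡 1).prod (𝓡 m)) (𝓡 m) ∞ (fun x : Circle × N => x.1 • x.2))
    (hsm : IsSmoothForm α) {x : F × ℝ} (hx : x ∈ sliceDomR d) :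
    extDeriv (E := F × ℝ) (α.pullback 𝓘(ℝ, F × ℝ) (sliceTrivR d)) x =
      ((mextDeriv α).pullback 𝓘(ℝ, F × ℝ) (sliceTrivR d)) x := by
  rw [← mextDeriv_eq_extDeriv]
  have hf : ∀ᶠ y in 𝓝 x, ContMDiffAt 𝓘(ℝ, F × ℝ) (𝓡 m) ∞ (sliceTrivR d) y := by
    filter_upwards [(isOpen_sliceDomR d).mem_nhds hx] with y hy
    exact (contMDiffOn_sliceTrivR d hθ).contMDiffAt ((isOpen_sliceDomR d).mem_nhds hy)
  exact mextDeriv_pullback_apply hf ((isSmoothForm_iff_smoothAt α).1 hsm _)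

omit [IsManifold (𝓡 m) ∞ N] in
/-- The composite `r ∘ sliceTrivR` of a `C^∞` function is differentiable on `dom × ℝ`, with
derivative `dr ∘ D(sliceTrivR)`. [folklore] -/
theorem hasFDerivAt_comp_sliceTrivR {r : N → ℝ}
    (hθ : ContMDiff ((𝓡 1).prod (𝓡 m)) (𝓡 m) ∞ (fun x : Circle × N => x.1 • x.2))
    (hr : ContMDiff (𝓡 m) 𝓘(ℝ, ℝ) ∞ r) {x : F × ℝ} (hx : x ∈ sliceDomR d) :
    HasFDerivAt (E := F × ℝ) (fun y ↦ r (sliceTrivR d y))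
      ((mfderiv (𝓡 m) 𝓘(ℝ, ℝ) r (sliceTrivR d x) : EuclideanSpace ℝ (Fin m) →L[ℝ] ℝ).comp
        (mfderiv 𝓘(ℝ, F × ℝ) (𝓡 m) (sliceTrivR d) x : F × ℝ →L[ℝ] EuclideanSpace ℝ (Fin m))) x := by
  have hT : MDifferentiableAt 𝓘(ℝ, F × ℝ) (𝓡 m) (sliceTrivR d) x :=
    ((contMDiffOn_sliceTrivR d hθ).contMDiffAt ((isOpen_sliceDomR d).mem_nhds hx)).mdifferentiableAt
      (by simp)
  have hR : MDifferentiableAt (𝓡 m) 𝓘(ℝ, ℝ) r (sliceTrivR d x) :=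
    (hr _).mdifferentiableAt (by simp)
  exact hasMFDerivAt_iff_hasFDerivAt.1 (hR.hasMFDerivAt.comp x hT.hasMFDerivAt)

end FlatData

/-! ### Local constancy of `∮θ + 2π H` -/

section Main

variable [IsManifold (𝓡 m) ∞ N] [T2Space N] [FiniteDimensional ℝ F]

/-- **The orbit period of `θ` plus `2π H` is locally constant** for a free smooth circle action
which is the Hamiltonian flow of an invariant function `H` (`σ(X, ·) = dH`, `dθ = σ`):
McLean's wrapping number `κ = (2π)⁻¹ ∮_{S¹·y} θ + H(y)` (there `H = -r²/2`) does not depend on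
`y` locally (McLean 2012, p. 36, with the normal form of p. 37, `X_{ν(r)} = -(ν'/r)∂_ϑ`).
[cite: Mclean2012, Lemma 5.17 (proof)] -/
theorem isLocallyConstant_orbitPeriod_add
    (hθ : ContMDiff ((𝓡 1).prod (𝓡 m)) (𝓡 m) ∞ (fun x : Circle × N => x.1 • x.2))
    (hfree : ∀ (a : Circle) (x : N), a • x = x → a = 1)
    (hF : Module.finrank ℝ F + 1 = m)
    {θ1 : MForm (𝓡 m) N ℝ 1} {σ2 : MForm (𝓡 m) N ℝ 2} (hθ1 : IsSmoothForm θ1)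
    (hd : mextDeriv θ1 = σ2) {H : N → ℝ} (hH : ContMDiff (𝓡 m) 𝓘(ℝ, ℝ) ∞ H)
    (hinv : ∀ (a : Circle) (x : N), H (a • x) = H x)
    (hT4 : ∀ (x : N) (w : TangentSpace (𝓡 m) x),
      σ2 x ![circleFundVec x, w] = mfderiv (𝓡 m) 𝓘(ℝ, ℝ) H x w) :
    IsLocallyConstant fun y : N ↦
      (∫ t in (0 : ℝ)..2 * π, θ1 (Circle.exp t • y) ![circleFundVec (Circle.exp t • y)]) +
        2 * π * H y := by
  set P : N → ℝ := fun y ↦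
    (∫ t in (0 : ℝ)..2 * π, θ1 (Circle.exp t • y) ![circleFundVec (Circle.exp t • y)]) +
      2 * π * H y with hP
  refine (IsLocallyConstant.iff_eventually_eq P).2 fun p ↦ ?_
  obtain ⟨d⟩ := nonempty_circleSliceData (F := F) hθ hfree hF p
  -- flat data of the slice model
  set β : F × ℝ → (F × ℝ) [⋀^Fin 1]→L[ℝ] ℝ := θ1.pullback 𝓘(ℝ, F × ℝ) (sliceTrivR d) with hβ
  set Om : F × ℝ → (F × ℝ) [⋀^Fin 2]→L[ℝ] ℝ := σ2.pullback 𝓘(ℝ, F × ℝ) (sliceTrivR d) with hOm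
  set R : F × ℝ → ℝ := fun y ↦ -2 * H (sliceTrivR d y) with hR
  have hO : IsOpen (sliceDomR d) := isOpen_sliceDomR d
  have hβs : ContDiffOn ℝ ∞ β (sliceDomR d) := contDiffOn_pullback_sliceTrivR d hθ hθ1
  have hdβ : ∀ y ∈ sliceDomR d, extDeriv β y = Om y := fun y hy ↦ by
    simp only [hβ, hOm]
    rw [extDeriv_pullback_sliceTrivR_eq d hθ hθ1 hy, hd]
  have hRinv : ∀ (u : F) (t : ℝ), R (u, t) = R (u, 0) := fun u t ↦ by
    simp only [hR, sliceTrivR]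
    rw [hinv, Circle.exp_zero, one_smul]
  have hRm : ∀ y ∈ sliceDomR d, HasMFDerivAt 𝓘(ℝ, F × ℝ) 𝓘(ℝ, ℝ) R y
      ((-2 : ℝ) • ((mfderiv (𝓡 m) 𝓘(ℝ, ℝ) H (sliceTrivR d y)).comp
        (mfderiv 𝓘(ℝ, F × ℝ) (𝓡 m) (sliceTrivR d) y))) := fun y hy ↦ by
    have hT : MDifferentiableAt 𝓘(ℝ, F × ℝ) (𝓡 m) (sliceTrivR d) y :=
      ((contMDiffOn_sliceTrivR d hθ).contMDiffAt (hO.mem_nhds hy)).mdifferentiableAt (by simp)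
    have hHd : MDifferentiableAt (𝓡 m) 𝓘(ℝ, ℝ) H (sliceTrivR d y) :=
      (hH _).mdifferentiableAt (by simp)
    exact (hHd.hasMFDerivAt.comp y hT.hasMFDerivAt).const_smul (-2)
  have hRdiff0 : ∀ y ∈ sliceDomR d, DifferentiableAt ℝ R y := fun y hy ↦
    mdifferentiableAt_iff_differentiableAt.1 (hRm y hy).mdifferentiableAt
  have hmomentR : ∀ y ∈ sliceDomR d, ∀ w : F × ℝ,
      Om y ![((0, 1) : F × ℝ), w] = -(1 / 2) * fderiv ℝ R y w := fun y hy w ↦ by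
    rw [← mfderiv_eq_fderiv, (hRm y hy).mfderiv]
    show (σ2.pullback 𝓘(ℝ, F × ℝ) (sliceTrivR d)) y ![((0, 1) : F × ℝ), w] =
      -(1 / 2) * ((-2 : ℝ) * @id ℝ (mfderiv (𝓡 m) 𝓘(ℝ, ℝ) H (sliceTrivR d y)
        (mfderiv 𝓘(ℝ, F × ℝ) (𝓡 m) (sliceTrivR d) y w)))
    rw [MForm.pullback_apply, comp_vecTwo, mfderiv_sliceTrivR_inr d hθ hy, hT4]
    show @id ℝ (mfderiv (𝓡 m) 𝓘(ℝ, ℝ) H (sliceTrivR d y)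
        (mfderiv 𝓘(ℝ, F × ℝ) (𝓡 m) (sliceTrivR d) y w)) =
      -(1 / 2) * ((-2 : ℝ) * @id ℝ (mfderiv (𝓡 m) 𝓘(ℝ, ℝ) H (sliceTrivR d y)
        (mfderiv 𝓘(ℝ, F × ℝ) (𝓡 m) (sliceTrivR d) y w)))
    ring
  -- the flat period function and its constancy on a ball of the slice
  obtain ⟨ρ, hρ, hball⟩ := Metric.isOpen_iff.1 d.isOpen_dom 0 d.zero_mem_dom
  have hQ : ∀ u ∈ Metric.ball (0 : F) ρ,
      (∫ t in (0 : ℝ)..2 * π, β (u, t) ![((0, 1) : F × ℝ)]) - π * R (u, 0) =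
        (∫ t in (0 : ℝ)..2 * π, β (0, t) ![((0, 1) : F × ℝ)]) - π * R (0, 0) := by
    intro u hu
    -- the family of lines over the segment from `0` to `u`
    set c : ℝ → F := fun s ↦ Real.smoothTransition s • u with hc
    have hcs : ContDiff ℝ ∞ c := Real.smoothTransition.contDiff.smul contDiff_const
    have hcmem : ∀ s, c s ∈ d.dom := fun s ↦ by
      refine hball ?_
      rw [Metric.mem_ball, dist_zero_right, hc, norm_smul, Real.norm_eq_abs,
        abs_of_nonneg (Real.smoothTransition.nonneg s)]
      calc Real.smoothTransition s * ‖u‖ ≤ 1 * ‖u‖ :=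
            mul_le_mul_of_nonneg_right (Real.smoothTransition.le_one s) (norm_nonneg u)
        _ < ρ := by rw [one_mul]; exact mem_ball_zero_iff.1 hu
    set Γ : ℝ × ℝ → F × ℝ := fun q ↦ (c q.2, q.1) with hΓ
    have hΓs : ContDiff ℝ ∞ Γ := (hcs.comp contDiff_snd).prodMk contDiff_fst
    have hΓO : ∀ q, Γ q ∈ sliceDomR d := fun q ↦ by
      simpa [sliceDomR, hΓ] using hcmem q.2
    have hDΓ : ∀ q : ℝ × ℝ, HasFDerivAt Γ
        (((fderiv ℝ c q.2).comp (ContinuousLinearMap.snd ℝ ℝ ℝ)).prod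
          (ContinuousLinearMap.fst ℝ ℝ ℝ)) q := fun q ↦
      (((hcs.differentiable (by simp)) q.2).hasFDerivAt.comp q hasFDerivAt_snd).prodMk
        hasFDerivAt_fst
    have hΓt : ∀ q : ℝ × ℝ, fderiv ℝ Γ q (1, 0) = ((0, 1) : F × ℝ) := fun q ↦ by
      rw [(hDΓ q).fderiv]
      simp
    have hΓs' : ∀ q : ℝ × ℝ, fderiv ℝ Γ q (0, 1) = ((fderiv ℝ c q.2 1, 0) : F × ℝ) := fun q ↦ by
      rw [(hDΓ q).fderiv]
      simp
    have hends : ∀ s, β (Γ (2 * π, s)) = β (Γ (0, s)) := fun s ↦ by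
      simp only [hΓ, hβ]
      have h := pullback_sliceTrivR_add_two_pi d θ1 hθ (hcmem s) 0
      rwa [zero_add] at h
    have hends' : ∀ s, fderiv ℝ Γ (2 * π, s) (0, 1) = fderiv ℝ Γ (0, s) (0, 1) := fun s ↦ by
      rw [hΓs', hΓs']
    have hRdiff : ∀ q, DifferentiableAt ℝ R (Γ q) := fun q ↦ hRdiff0 _ (hΓO q)
    have hRinv' : ∀ t s, R (Γ (t, s)) = R (Γ (0, s)) := fun t s ↦ by
      simp only [hΓ]
      rw [hRinv (c s) t, hRinv (c s) 0]
    have hmomentΓ : ∀ q (w : F × ℝ),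
        Om (Γ q) ![fderiv ℝ Γ q (1, 0), w] = -(1 / 2) * fderiv ℝ R (Γ q) w := fun q w ↦ by
      rw [hΓt]
      exact hmomentR _ (hΓO q) w
    have key := orbitPeriod_sub_eq_of_ends (E := F × ℝ) hO hβs hdβ hΓs hΓO hends hends'
      hRdiff hRinv' hmomentΓ 1 0
    have hc1 : c 1 = u := by
      simp only [hc, Real.smoothTransition.one_of_one_le le_rfl, one_smul]
    have hc0 : c 0 = 0 := by
      simp only [hc, Real.smoothTransition.zero_of_nonpos le_rfl, zero_smul]
    simp only [hΓt] at key
    simp only [hΓ, hc1, hc0] at key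
    exact key
  -- the period function read in the slice model
  have hPT : ∀ u ∈ d.dom, ∀ t₀ : ℝ,
      P (sliceTrivR d (u, t₀)) =
        (∫ t in (0 : ℝ)..2 * π, β (u, t) ![((0, 1) : F × ℝ)]) - π * R (u, 0) := by
    intro u hu t₀
    simp only [hP]
    have h1 : ∀ t, θ1 (Circle.exp t • sliceTrivR d (u, t₀))
        ![circleFundVec (Circle.exp t • sliceTrivR d (u, t₀))] =
          β (u, t₀ + t) ![((0, 1) : F × ℝ)] :=
      fun t ↦ orbitIntegrand_sliceTrivR d θ1 hθ hu t₀ t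
    simp_rw [h1]
    have hper : Function.Periodic (fun t ↦ β (u, t) ![((0, 1) : F × ℝ)]) (2 * π) := fun t ↦ by
      have h := pullback_sliceTrivR_add_two_pi d θ1 hθ hu t
      simp only [hβ]
      exact congrArg (fun M : (F × ℝ) [⋀^Fin 1]→L[ℝ] ℝ ↦ M ![((0, 1) : F × ℝ)]) h
    have h2 : ∫ t in (0 : ℝ)..2 * π, β (u, t₀ + t) ![((0, 1) : F × ℝ)] =
        ∫ t in (0 : ℝ)..2 * π, β (u, t) ![((0, 1) : F × ℝ)] := by
      have h := Literature.Analysis.FunctionSpaces.intervalIntegral_comp_add_period hper t₀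
      simp_rw [add_comm _ t₀] at h
      exact h
    rw [h2]
    have h3 : 2 * π * H (sliceTrivR d (u, t₀)) = -(π * R (u, 0)) := by
      rw [← hRinv u t₀]
      simp only [hR]
      ring
    rw [h3, sub_eq_add_neg]
  -- every point near `p` is `sliceTrivR (coord y, angle y)` with small coordinate
  have hp : P p = (∫ t in (0 : ℝ)..2 * π, β (0, t) ![((0, 1) : F × ℝ)]) - π * R (0, 0) := by
    have h := hPT 0 d.zero_mem_dom 0
    rwa [show sliceTrivR d ((0 : F), (0 : ℝ)) = p by
      simp [sliceTrivR, d.param_zero]] at h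
  have hnhds : ∀ᶠ y in 𝓝 p, y ∈ d.T ∧ d.coord y ∈ Metric.ball (0 : F) ρ := by
    have h1 : ∀ᶠ y in 𝓝 p, y ∈ d.T := d.hTo.mem_nhds d.hpT
    have h2 : ContinuousAt d.coord p :=
      (d.continuousOn_coord.continuousWithinAt d.hpT).continuousAt (d.hTo.mem_nhds d.hpT)
    have h3 : d.coord p = 0 := by
      have h := d.coord_param d.zero_mem_dom
      rwa [d.param_zero] at h
    have h4 : ∀ᶠ y in 𝓝 p, d.coord y ∈ Metric.ball (0 : F) ρ := by
      apply h2.preimage_mem_nhds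
      rw [h3]
      exact Metric.ball_mem_nhds 0 hρ
    exact h1.and h4
  filter_upwards [hnhds] with y hy
  have hy' : y = sliceTrivR d (d.coord y, d.angle y) := by
    simp only [sliceTrivR]
    exact (d.exp_angle_smul_param_coord hy.1).symm
  rw [hy', hPT _ (d.coord_mem_dom hy.1), hQ _ hy.2, ← hp]

end Main

end Literature.Geometry.Symplectic
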